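import Summits.AtomisticToContinuum.HydrodynamicLimit.Theorems.StiffCollisionalRelaxationAprioriBoundsMesoPartOneOfOccupation
import Summits.AtomisticToContinuum.HydrodynamicLimit.Theorems.StiffCollisionalRelaxationAprioriBoundsMesoOccupationInProb
import Summits.AtomisticToContinuum.HydrodynamicLimit.Theorems.StiffCollisionalRelaxationAprioriBoundsMesoCapstones
import Summits.AtomisticToContinuum.HydrodynamicLimit.Theorems.StiffCollisionalRelaxationAprioriBoundsFibreFarTail
import Summits.AtomisticToContinuum.HydrodynamicLimit.Theorems.StiffCollisionalRelaxationAprioriBoundsEquilibriumPartOne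
import Summits.AtomisticToContinuum.HydrodynamicLimit.Theorems.StiffCollisionalRelaxationAprioriBoundsPartTwoOfKineticRangeControl
import HarnessLib

/-!
# The (i)-residue of the a-priori crux made EXACT: the in-probability occupation profile is NECESSARY
(line `meso-chebyshev-window`, crux `AprioriBounds` = stmt-AtomisticToContinuum-14827, lead c11, cycle 4)

Support file (`--supports stmt-AtomisticToContinuum-14827`).  Write `occ_K(z) := (∫⁻₀ᵗ frac_K(Φ_s z) ds).toReal ∈ [0,t]`
for the time-integrated one-particle tail occupation at level `K` and `X_N(z) := ∫₀ᵗ (N+1)⁻¹∑ᵢ e^{λ|vᵢ(s)|²} ds` for the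
time-averaged exponential moment of component (i) (`PartOneAt`: `∃ λ > 0, C, P_N{C < X_N} → 0`).  The hypothesis of the
LANDED dial `stub_partOne_of_occupation` (p142615) is the IN-PROBABILITY OCCUPATION PROFILE
  `OccupationInProb(σ, profiles, Φ, t) :≡ ∃ Θ > 0, A, ∀ K, ∀ η > 0, P_N{ t·A·e^{−K/(2Θ)} + η < occ_K } → 0`.
Cycles 1–3 produced it from SUFFICIENT third children (`OccupationVariance` ⟺ `PairDecorrelation` ⟸ `FixedTimeTailVariance`
⟸ stmt-17603), none of which is implied by the crux.  THIS FILE PROVES THAT `OccupationInProb` ITSELF IS NECESSARY: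

* `exp_mul_occupation_le_timeAvg_expMoment` — on a good orbit, for `λ ≥ 0` and every level `K`,
  `e^{λK} · occ_K(z) ≤ X_N(z)` (Markov at one configuration, `frac_le_exp_neg_mul_avg`, integrated in time; `X_N` is a
  genuine Bochner integral because the integrand is bounded by `e^{2λE(z)}` through energy conservation).
* `measure_occupationEvent_le_partOneEvent` — hence `P_N{C⁺e^{−λK} + η < occ_K} ≤ P_N{C < X_N}` for all `N, K, η ≥ 0`
  (`C⁺ = max C 0`; the law charges only good orbits).
* `occupationInProb_of_partOne` — `PartOneAt ⟹ OccupationInProb` with `Θ := 1/(2λ)`, `A := C⁺/t` (no normalisation, no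
  profile hypothesis); with the landed converse: `partOne_iff_occupationInProb` (given `FarTailAllAt`, `0 < σ ≤ 1/2`).
* Under the crux prefix: `occupationInProb_of_aprioriBounds` (the crux implies the prefix form `OccupationInProbPrefix`),
  `partOne_of_farTailAll_occupationInProb`, and the capstones
  `AprioriBounds_of_KRC_GT_occupationInProb : KineticRangeControl → GaussianTails → OccupationInProbPrefix → AprioriBounds`,
  `aprioriBounds_iff_partTwo_and_occupationInProb_of_GT : GaussianTails → (AprioriBounds ↔ PartTwoPrefix ∧ OccupationInProbPrefix)`,
  `aprioriBounds_iff_occupationInProb_of_KRC_GT : KineticRangeControl → GaussianTails → (AprioriBounds ↔ OccupationInProbPrefix)`.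
  So MODULO THE TWO EXISTING XL ITEMS stmt-9201 / stmt-14415 THE CRUX IS EQUIVALENT TO `OccupationInProbPrefix`: the third
  child of the D3 split (`Cruxes/AprioriBounds/D3-SPLIT.md`) can be filed as a COROLLARY of stmt-14827 (lossless split), and
  every r3 child still docks into it (`occupationInProb_of_GT_occupationVariance`, `occupationInProb_of_GT_maxwellianOneBodyInBand`).
* Rung for free: `occupationInProb_homogeneous` (equilibrium, every flow family, from the PROVED equilibrium (i)).
No new definitions, no named facts; axioms `propext`, `Classical.choice`, `Quot.sound`. -/

noncomputable section

open MeasureTheory ProbabilityTheory Filter Set Topology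
open scoped ENNReal

namespace Summit.AtomisticToContinuum.HydrodynamicLimit.Theorems.MesoChebyshevWindow

open Literature.MathematicalPhysics.KineticTheory Literature.Analysis.FluidPDE
open Summit.AtomisticToContinuum.HydrodynamicLimit.Theorems.AprioriBoundsNegative (PartOneAt PartTwoAt)
open Summit.AtomisticToContinuum.HydrodynamicLimit.Theorems.VisitLedgerUpscattering (Cfg Flow Flows NiceProfiles)
open Summit.AtomisticToContinuum.HydrodynamicLimit.Theorems.FibreDeficitTransfer

/-! ## The orbit inequality `e^{λK}·occ_K ≤ X_N` -/

/-- **`e^{λK} · occ_K(z) ≤ ∫₀ᵗ (N+1)⁻¹∑ᵢ e^{λ|vᵢ(s)|²} ds` along a good orbit.**  For a hard-sphere flow `Φ`, a good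
initial datum `z`, `λ ≥ 0`, any level `K` and horizon `t`: Markov at one configuration (`frac_le_exp_neg_mul_avg`:
`frac_K(w) ≤ e^{−λK}(N+1)⁻¹∑ᵢe^{λ|vᵢ|²}`) integrated over `s ∈ [0,t]`; both time integrands are measurable along the orbit
(`IsHardSphereTrajectory.measurable_torus`) and bounded (`frac ∈ [0,1]`; the moment by `e^{2λE(z)}`, energy conservation
`configEnergy_flow`), so the lower Lebesgue integral of `frac` is the Bochner one and the moment is Bochner integrable. -/
theorem exp_mul_occupation_le_timeAvg_expMoment {N : ℕ} {ε : ℝ}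
    (Φ : HardSphereFlow (Torus.geometry (Fin 3)) ε (N + 1)) {z : Cfg N} (hz : z ∈ Φ.good)
    {lam : ℝ} (hlam : 0 ≤ lam) (K t : ℝ) :
    Real.exp (lam * K) * (∫⁻ s in Icc 0 t, ENNReal.ofReal (frac K (Φ.flow s z))).toReal ≤
      ∫ s in Icc 0 t, ((N + 1 : ℕ) : ℝ)⁻¹ * ∑ i, Real.exp (lam * ‖(Φ.flow s z i).2‖ ^ 2) := by
  set ν : Measure ℝ := volume.restrict (Icc 0 t) with hν
  set G : Cfg N → ℝ := fun w => ((N + 1 : ℕ) : ℝ)⁻¹ * ∑ i, Real.exp (lam * ‖(w i).2‖ ^ 2) with hG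
  have hGm : Measurable G :=
    measurable_const.mul (Finset.measurable_sum _ fun i _ =>
      (measurable_pi_apply i).snd.norm.pow_const 2 |>.const_mul lam |>.exp)
  have hG0 : ∀ w, 0 ≤ G w := fun w => mul_nonneg (by positivity) (Finset.sum_nonneg fun i _ => (Real.exp_pos _).le)
  have horb : Measurable fun s => Φ.flow s z := (Φ.isTrajectory z hz).measurable_torus
  have hbdd : ∀ s, G (Φ.flow s z) ≤ Real.exp (lam * (2 * configEnergy z)) := fun s =>
    Φ.configEnergy_flow hz s ▸ AprioriBoundsNegative.expAvg_le_exp_lam_energy (N := N) hlam (Φ.flow s z)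
  have hGi : Integrable (fun s => G (Φ.flow s z)) ν := by
    refine Measure.integrableOn_of_bounded (M := Real.exp (lam * (2 * configEnergy z)))
      measure_Icc_lt_top.ne (hGm.comp horb).aestronglyMeasurable (ae_of_all _ fun s => ?_)
    rw [Real.norm_eq_abs, abs_of_nonneg (hG0 _)]
    exact hbdd s
  -- Markov at each time: `e^{λK} frac_K ≤ G`
  have hpt : ∀ s, Real.exp (lam * K) * frac K (Φ.flow s z) ≤ G (Φ.flow s z) := by
    intro s
    have h := frac_le_exp_neg_mul_avg hlam K (Φ.flow s z)
    calc Real.exp (lam * K) * frac K (Φ.flow s z)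
        ≤ Real.exp (lam * K) * (Real.exp (-(lam * K)) * G (Φ.flow s z)) :=
          mul_le_mul_of_nonneg_left h (Real.exp_pos _).le
      _ = G (Φ.flow s z) := by
          rw [← mul_assoc, ← Real.exp_add, add_neg_cancel, Real.exp_zero, one_mul]
  -- the occupation is a Bochner integral of a `[0,1]`-valued measurable function
  have hfm : Measurable fun s => frac K (Φ.flow s z) := (measurable_frac K).comp horb
  have hfi : Integrable (fun s => frac K (Φ.flow s z)) ν := by
    refine Measure.integrableOn_of_bounded (M := 1) measure_Icc_lt_top.ne hfm.aestronglyMeasurable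
      (ae_of_all _ fun s => ?_)
    rw [Real.norm_eq_abs, abs_of_nonneg (frac_mem_Icc _ _).1]
    exact (frac_mem_Icc _ _).2
  have hocc : (∫⁻ s, ENNReal.ofReal (frac K (Φ.flow s z)) ∂ν).toReal = ∫ s, frac K (Φ.flow s z) ∂ν := by
    rw [← ofReal_integral_eq_lintegral_ofReal hfi (ae_of_all _ fun s => (frac_mem_Icc _ _).1),
      ENNReal.toReal_ofReal (integral_nonneg fun s => (frac_mem_Icc _ _).1)]
  change Real.exp (lam * K) * (∫⁻ s, ENNReal.ofReal (frac K (Φ.flow s z)) ∂ν).toReal ≤ ∫ s, G (Φ.flow s z) ∂ν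
  rw [hocc, ← integral_const_mul]
  exact integral_mono (hfi.const_mul _) hGi fun s => hpt s

/-! ## Necessity at one particle number: the occupation event sits inside the (i)-event -/

/-- **`P_N{C⁺e^{−λK} + η < occ_K} ≤ P_N{C < X_N}`** for one flow of `N + 1` spheres, `λ ≥ 0`, any `C, K, t` and `η ≥ 0`
(`C⁺ = max C 0`): off the null set of bad orbits (`measure_compl_good`, absolute continuity of the local Gibbs law), a
violation of the occupation threshold forces `C ≤ C⁺ < e^{λK} occ_K ≤ X_N` (`exp_mul_occupation_le_timeAvg_expMoment`). -/
theorem measure_occupationEvent_le_partOneEvent {σ : ℝ} {a₀ θ₀ : T3 → ℝ} {u₀ : T3 → V3} {N : ℕ}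
    (Φ : HardSphereFlow (Torus.geometry (Fin 3)) (hsDiameter σ N) (N + 1))
    {lam : ℝ} (hlam : 0 ≤ lam) (C K t : ℝ) {η : ℝ} (hη : 0 ≤ η) :
    localGibbsLaw σ a₀ u₀ θ₀ N Φ
        {z | max C 0 * Real.exp (-(lam * K)) + η <
          (∫⁻ s in Icc 0 t, ENNReal.ofReal (frac K (Φ.flow s z))).toReal} ≤
      localGibbsLaw σ a₀ u₀ θ₀ N Φ
        {z | C < ∫ s in Icc 0 t, ∫ y, Real.exp (lam * ‖y.2‖ ^ 2) ∂(empiricalMeasure (Φ.flow s z))} := by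
  set P : Measure (Cfg N) := localGibbsLaw σ a₀ u₀ θ₀ N Φ with hPdef
  have hgood0 : P Φ.goodᶜ = 0 := by
    rw [hPdef, localGibbsLaw_eq]
    exact (localGibbsMeasure_absolutelyContinuous σ _ _ _ N Φ) Φ.measure_compl_good
  have hincl : {z : Cfg N | max C 0 * Real.exp (-(lam * K)) + η <
        (∫⁻ s in Icc 0 t, ENNReal.ofReal (frac K (Φ.flow s z))).toReal} ⊆
      Φ.goodᶜ ∪ {z | C < ∫ s in Icc 0 t, ∫ y, Real.exp (lam * ‖y.2‖ ^ 2) ∂(empiricalMeasure (Φ.flow s z))} := by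
    intro z hz1
    by_cases hz : z ∈ Φ.good
    swap; · exact Or.inl hz
    right
    simp only [mem_setOf_eq, integral_empiricalMeasure] at hz1 ⊢
    have horb := exp_mul_occupation_le_timeAvg_expMoment Φ hz hlam K t
    have hE : 0 < Real.exp (lam * K) := Real.exp_pos _
    have h1 : max C 0 * Real.exp (-(lam * K)) < (∫⁻ s in Icc 0 t, ENNReal.ofReal (frac K (Φ.flow s z))).toReal := by
      linarith
    have hEE : Real.exp (lam * K) * Real.exp (-(lam * K)) = 1 := by
      rw [← Real.exp_add, add_neg_cancel, Real.exp_zero]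
    have h2 : max C 0 < Real.exp (lam * K) * (∫⁻ s in Icc 0 t, ENNReal.ofReal (frac K (Φ.flow s z))).toReal :=
      calc max C 0 = Real.exp (lam * K) * (max C 0 * Real.exp (-(lam * K))) := by
            linear_combination (-(max C 0)) * hEE
        _ < _ := mul_lt_mul_of_pos_left h1 hE
    exact (le_max_left C 0).trans_lt (h2.trans_le horb)
  calc P {z | max C 0 * Real.exp (-(lam * K)) + η <
          (∫⁻ s in Icc 0 t, ENNReal.ofReal (frac K (Φ.flow s z))).toReal}
      ≤ P (Φ.goodᶜ ∪ {z | C < ∫ s in Icc 0 t, ∫ y, Real.exp (lam * ‖y.2‖ ^ 2)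
          ∂(empiricalMeasure (Φ.flow s z))}) := measure_mono hincl
    _ ≤ P Φ.goodᶜ + P {z | C < ∫ s in Icc 0 t, ∫ y, Real.exp (lam * ‖y.2‖ ^ 2)
          ∂(empiricalMeasure (Φ.flow s z))} := measure_union_le _ _
    _ = _ := by rw [hgood0, zero_add]

/-! ## Necessity: `PartOneAt ⟹ OccupationInProb` -/

/-- **NECESSITY OF THE IN-PROBABILITY OCCUPATION PROFILE.**  For any `σ`, profiles, flow family and `t > 0`: component (i)
of the crux at this instance (`PartOneAt`, witnesses `λ > 0`, `C`) implies the hypothesis of the landed dial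
`stub_partOne_of_occupation` — `∃ Θ > 0, A, ∀ K, ∀ η > 0, P_N{tAe^{−K/(2Θ)} + η < occ_K} → 0` — with `Θ := 1/(2λ)`,
`A := C⁺/t`: at each `N` the occupation event has probability at most that of the (i)-event
(`measure_occupationEvent_le_partOneEvent`), which tends to `0`. -/
theorem occupationInProb_of_partOne :
    ∀ (σ : ℝ) (a₀ θ₀ : T3 → ℝ) (u₀ : T3 → V3)
      (Φ : (N : ℕ) → HardSphereFlow (Torus.geometry (Fin 3)) (hsDiameter σ N) (N + 1)) (t : ℝ),
      0 < t → PartOneAt σ a₀ θ₀ u₀ Φ t →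
        ∃ Θ A : ℝ, 0 < Θ ∧ ∀ K : ℝ, ∀ η : ℝ, 0 < η →
          Tendsto (fun N : ℕ => localGibbsLaw σ a₀ u₀ θ₀ N (Φ N)
            {z | t * A * Real.exp (-(K / (2 * Θ))) + η <
              (∫⁻ s in Icc 0 t, ENNReal.ofReal (frac K ((Φ N).flow s z))).toReal}) atTop (𝓝 0) := by
  intro σ a₀ θ₀ u₀ Φ t ht hI
  obtain ⟨lam, C, hlam, hT⟩ := hI
  refine ⟨1 / (2 * lam), max C 0 / t, by positivity, fun K η hη => ?_⟩
  have hl : lam ≠ 0 := hlam.ne'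
  have htne : t ≠ 0 := ht.ne'
  have h1 : t * (max C 0 / t) = max C 0 := by field_simp
  have h2 : K / (2 * (1 / (2 * lam))) = lam * K := by field_simp
  rw [h1, h2]
  exact tendsto_of_tendsto_of_tendsto_of_le_of_le tendsto_const_nhds hT (fun _ => zero_le) fun N =>
    measure_occupationEvent_le_partOneEvent (Φ N) hlam.le C K t hη.le

/-- **Component (i) ⟺ the in-probability occupation profile, given far tails in the mean.**  For `0 < σ ≤ 1/2`, nice
profiles, `t > 0` and `FarTailAllAt σ a₀ θ₀ u₀ Φ t` (⇐ stmt-14415 under the crux prefix, `farTailAll_of_gaussianTails`):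
`PartOneAt ↔ OccupationInProb` (`⟹` `occupationInProb_of_partOne`, unconditional; `⟸` the landed dial
`stub_partOne_of_occupation`, p142615). -/
theorem partOne_iff_occupationInProb (σ : ℝ) (a₀ θ₀ : T3 → ℝ) (u₀ : T3 → V3)
    (Φ : (N : ℕ) → HardSphereFlow (Torus.geometry (Fin 3)) (hsDiameter σ N) (N + 1)) (t : ℝ)
    (hσ : 0 < σ) (hσ2 : σ ≤ 1 / 2) (hP : NiceProfiles a₀ θ₀ u₀) (ht : 0 < t)
    (hFar : FarTailAllAt σ a₀ θ₀ u₀ Φ t) :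
    PartOneAt σ a₀ θ₀ u₀ Φ t ↔
      ∃ Θ A : ℝ, 0 < Θ ∧ ∀ K : ℝ, ∀ η : ℝ, 0 < η →
        Tendsto (fun N : ℕ => localGibbsLaw σ a₀ u₀ θ₀ N (Φ N)
          {z | t * A * Real.exp (-(K / (2 * Θ))) + η <
            (∫⁻ s in Icc 0 t, ENNReal.ofReal (frac K ((Φ N).flow s z))).toReal}) atTop (𝓝 0) :=
  ⟨occupationInProb_of_partOne σ a₀ θ₀ u₀ Φ t ht,
    fun h => stub_partOne_of_occupation σ a₀ θ₀ u₀ Φ t hσ hσ2 hP ht h hFar⟩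

/-- **Equilibrium rung of `OccupationInProb`, for free.**  For `σ ≤ 1/2`, `θ₀ > 0`, the homogeneous profiles `(1, θ₀, 0)`,
EVERY flow family and every `t > 0`, the occupation profile holds in probability — from the PROVED equilibrium (i)
(`AdiabatCeiling.partOneAt_equilibrium`) by necessity. -/
theorem occupationInProb_homogeneous (σ θ₀ : ℝ) (hσ2 : σ ≤ 1 / 2) (hθ : 0 < θ₀)
    (Φ : (N : ℕ) → HardSphereFlow (Torus.geometry (Fin 3)) (hsDiameter σ N) (N + 1)) (t : ℝ) (ht : 0 < t) :
    ∃ Θ A : ℝ, 0 < Θ ∧ ∀ K : ℝ, ∀ η : ℝ, 0 < η →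
      Tendsto (fun N : ℕ => localGibbsLaw σ (fun _ => 1) (fun _ => 0) (fun _ => θ₀) N (Φ N)
        {z | t * A * Real.exp (-(K / (2 * Θ))) + η <
          (∫⁻ s in Icc 0 t, ENNReal.ofReal (frac K ((Φ N).flow s z))).toReal}) atTop (𝓝 0) :=
  occupationInProb_of_partOne σ (fun _ => 1) (fun _ => θ₀) (fun _ => 0) Φ t ht
    (AdiabatCeiling.partOneAt_equilibrium hσ2 hθ Φ ht)

/-! ## Under the crux prefix -/

/-- **The crux implies the in-probability occupation profile under its own prefix** (`OccupationInProbPrefix`, the EXACT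
third child): same thresholds `σ₀, η₁` as the crux; at each instance `occupationInProb_of_partOne` applied to component (i). -/
theorem occupationInProb_of_aprioriBounds :
    Summit.AtomisticToContinuum.HydrodynamicLimit.Theses.StiffCollisionalRelaxation.AprioriBounds →
    ∀ (a₀ θ₀ : T3 → ℝ) (u₀ : T3 → V3), Continuous a₀ → Continuous θ₀ → Continuous u₀ →
      (∀ x, 0 < a₀ x) → (∀ x, 0 < θ₀ x) →
      ∃ σ₀ : ℝ, 0 < σ₀ ∧ ∃ η₁ : ℝ, 0 < η₁ ∧ ∀ σ : ℝ, 0 < σ → σ < σ₀ →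
        ∀ (T : ℝ) (ρ θ : ℝ → T3 → ℝ) (u : ℝ → T3 → V3), IsHardSphereEulerSolution σ T ρ u θ →
        ∀ Φ : (N : ℕ) → HardSphereFlow (Torus.geometry (Fin 3)) (hsDiameter σ N) (N + 1),
          TendstoHydroFieldsAt (fun N => localGibbsLaw σ a₀ u₀ θ₀ N (Φ N)) Φ ρ u θ 0 →
          ∀ t : ℝ, 0 < t → t < T → (∀ s ∈ Icc 0 t, ∀ x, 2 * ρ s x * σ ^ 3 < η₁) →
            ∃ Θ A : ℝ, 0 < Θ ∧ ∀ K : ℝ, ∀ η : ℝ, 0 < η →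
              Tendsto (fun N : ℕ => localGibbsLaw σ a₀ u₀ θ₀ N (Φ N)
                {z | t * A * Real.exp (-(K / (2 * Θ))) + η <
                  (∫⁻ s in Icc 0 t, ENNReal.ofReal (frac K ((Φ N).flow s z))).toReal}) atTop (𝓝 0) := by
  intro h a₀ θ₀ u₀ ha hθ hu ha0 hθ0
  obtain ⟨σ₀, hσ₀, η₁, hη₁, H⟩ := (AprioriBoundsNegative.aprioriBounds_iff.1 h) a₀ θ₀ u₀ ha hθ hu ha0 hθ0
  refine ⟨σ₀, hσ₀, η₁, hη₁, fun σ hσ hσlt T ρ θ u hsol Φ hLLN t ht htT hdil => ?_⟩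
  exact occupationInProb_of_partOne σ a₀ θ₀ u₀ Φ t ht (H σ hσ hσlt T ρ θ u hsol Φ hLLN t ht htT hdil).1

/-- **Component (i) under the crux prefix from `FarTailAll` (prefix form, ⇐ stmt-14415) and `OccupationInProbPrefix`**, through the
landed dial `stub_partOne_of_occupation`; thresholds `σ₀ := min (min σ₅ σ₆) (1/2)`, `η₁ := min η₅ η₆`. -/
theorem partOne_of_farTailAll_occupationInProb
    (h5 : ∀ (a₀ θ₀ : T3 → ℝ) (u₀ : T3 → V3), Continuous a₀ → Continuous θ₀ → Continuous u₀ →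
      (∀ x, 0 < a₀ x) → (∀ x, 0 < θ₀ x) →
      ∃ σ₀ : ℝ, 0 < σ₀ ∧ ∃ η₁ : ℝ, 0 < η₁ ∧ ∀ σ : ℝ, 0 < σ → σ < σ₀ →
        ∀ (T : ℝ) (ρ θ : ℝ → T3 → ℝ) (u : ℝ → T3 → V3), IsHardSphereEulerSolution σ T ρ u θ →
        ∀ Φ : (N : ℕ) → HardSphereFlow (Torus.geometry (Fin 3)) (hsDiameter σ N) (N + 1),
          TendstoHydroFieldsAt (fun N => localGibbsLaw σ a₀ u₀ θ₀ N (Φ N)) Φ ρ u θ 0 →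
          ∀ t : ℝ, 0 < t → t < T → (∀ s ∈ Icc 0 t, ∀ x, 2 * ρ s x * σ ^ 3 < η₁) →
            FarTailAllAt σ a₀ θ₀ u₀ Φ t)
    (h6 : ∀ (a₀ θ₀ : T3 → ℝ) (u₀ : T3 → V3), Continuous a₀ → Continuous θ₀ → Continuous u₀ →
      (∀ x, 0 < a₀ x) → (∀ x, 0 < θ₀ x) →
      ∃ σ₀ : ℝ, 0 < σ₀ ∧ ∃ η₁ : ℝ, 0 < η₁ ∧ ∀ σ : ℝ, 0 < σ → σ < σ₀ →
        ∀ (T : ℝ) (ρ θ : ℝ → T3 → ℝ) (u : ℝ → T3 → V3), IsHardSphereEulerSolution σ T ρ u θ →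
        ∀ Φ : (N : ℕ) → HardSphereFlow (Torus.geometry (Fin 3)) (hsDiameter σ N) (N + 1),
          TendstoHydroFieldsAt (fun N => localGibbsLaw σ a₀ u₀ θ₀ N (Φ N)) Φ ρ u θ 0 →
          ∀ t : ℝ, 0 < t → t < T → (∀ s ∈ Icc 0 t, ∀ x, 2 * ρ s x * σ ^ 3 < η₁) →
            ∃ Θ A : ℝ, 0 < Θ ∧ ∀ K : ℝ, ∀ η : ℝ, 0 < η →
              Tendsto (fun N : ℕ => localGibbsLaw σ a₀ u₀ θ₀ N (Φ N)
                {z | t * A * Real.exp (-(K / (2 * Θ))) + η <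
                  (∫⁻ s in Icc 0 t, ENNReal.ofReal (frac K ((Φ N).flow s z))).toReal}) atTop (𝓝 0)) :
    ∀ (a₀ θ₀ : T3 → ℝ) (u₀ : T3 → V3), Continuous a₀ → Continuous θ₀ → Continuous u₀ →
      (∀ x, 0 < a₀ x) → (∀ x, 0 < θ₀ x) →
      ∃ σ₀ : ℝ, 0 < σ₀ ∧ ∃ η₁ : ℝ, 0 < η₁ ∧ ∀ σ : ℝ, 0 < σ → σ < σ₀ →
        ∀ (T : ℝ) (ρ θ : ℝ → T3 → ℝ) (u : ℝ → T3 → V3), IsHardSphereEulerSolution σ T ρ u θ →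
        ∀ Φ : (N : ℕ) → HardSphereFlow (Torus.geometry (Fin 3)) (hsDiameter σ N) (N + 1),
          TendstoHydroFieldsAt (fun N => localGibbsLaw σ a₀ u₀ θ₀ N (Φ N)) Φ ρ u θ 0 →
          ∀ t : ℝ, 0 < t → t < T → (∀ s ∈ Icc 0 t, ∀ x, 2 * ρ s x * σ ^ 3 < η₁) →
            PartOneAt σ a₀ θ₀ u₀ Φ t := by
  intro a₀ θ₀ u₀ ha hθ hu ha0 hθ0
  have hP : NiceProfiles a₀ θ₀ u₀ := ⟨ha, hθ, hu, ha0, hθ0⟩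
  obtain ⟨σ₅, hσ₅, η₅, hη₅, H5⟩ := h5 a₀ θ₀ u₀ ha hθ hu ha0 hθ0
  obtain ⟨σ₆, hσ₆, η₆, hη₆, H6⟩ := h6 a₀ θ₀ u₀ ha hθ hu ha0 hθ0
  refine ⟨min (min σ₅ σ₆) (1 / 2), lt_min (lt_min hσ₅ hσ₆) one_half_pos, min η₅ η₆, lt_min hη₅ hη₆, ?_⟩
  intro σ hσ hσlt T ρ θ u hsol Φ hLLN t ht htT hdil
  simp only [lt_min_iff] at hσlt hdil
  obtain ⟨⟨hs5, hs6⟩, hshalf⟩ := hσlt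
  have hFar : FarTailAllAt σ a₀ θ₀ u₀ Φ t :=
    H5 σ hσ hs5 T ρ θ u hsol Φ hLLN t ht htT (fun s hs x => (hdil s hs x).1)
  have hOcc := H6 σ hσ hs6 T ρ θ u hsol Φ hLLN t ht htT (fun s hs x => (hdil s hs x).2)
  exact stub_partOne_of_occupation σ a₀ θ₀ u₀ Φ t hσ hshalf.le hP ht hOcc hFar

/-! ## Capstones r4: the crux is EQUIVALENT to `OccupationInProbPrefix` modulo the two existing XL items -/

/-- **`AprioriBounds ⇐ KineticRangeControl (stmt-9201) ∧ GaussianTails (stmt-14415) ∧ OccupationInProbPrefix`** — the D3 split with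
its one new child in EXACT form (a corollary of the crux, `occupationInProb_of_aprioriBounds`): (ii) from 9201
(`AdiabatCeiling.partTwo_of_kineticRangeControl`), (i) from 14415 ∧ the child (`partOne_of_farTailAll_occupationInProb`). -/
theorem AprioriBounds_of_KRC_GT_occupationInProb :
    Summit.AtomisticToContinuum.HydrodynamicLimit.Theses.GermanoSplitLES.KineticRangeControl →
    Summit.AtomisticToContinuum.HydrodynamicLimit.Theses.UGibbsSRBRigidity.GaussianTails →
    (∀ (a₀ θ₀ : T3 → ℝ) (u₀ : T3 → V3), Continuous a₀ → Continuous θ₀ → Continuous u₀ →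
      (∀ x, 0 < a₀ x) → (∀ x, 0 < θ₀ x) →
      ∃ σ₀ : ℝ, 0 < σ₀ ∧ ∃ η₁ : ℝ, 0 < η₁ ∧ ∀ σ : ℝ, 0 < σ → σ < σ₀ →
        ∀ (T : ℝ) (ρ θ : ℝ → T3 → ℝ) (u : ℝ → T3 → V3), IsHardSphereEulerSolution σ T ρ u θ →
        ∀ Φ : (N : ℕ) → HardSphereFlow (Torus.geometry (Fin 3)) (hsDiameter σ N) (N + 1),
          TendstoHydroFieldsAt (fun N => localGibbsLaw σ a₀ u₀ θ₀ N (Φ N)) Φ ρ u θ 0 →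
          ∀ t : ℝ, 0 < t → t < T → (∀ s ∈ Icc 0 t, ∀ x, 2 * ρ s x * σ ^ 3 < η₁) →
            ∃ Θ A : ℝ, 0 < Θ ∧ ∀ K : ℝ, ∀ η : ℝ, 0 < η →
              Tendsto (fun N : ℕ => localGibbsLaw σ a₀ u₀ θ₀ N (Φ N)
                {z | t * A * Real.exp (-(K / (2 * Θ))) + η <
                  (∫⁻ s in Icc 0 t, ENNReal.ofReal (frac K ((Φ N).flow s z))).toReal}) atTop (𝓝 0)) →
    Summit.AtomisticToContinuum.HydrodynamicLimit.Theses.StiffCollisionalRelaxation.AprioriBounds :=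
  fun hKRC hGT h6 => aprioriBounds_of_partOne_partTwo
    (partOne_of_farTailAll_occupationInProb (farTailAll_of_gaussianTails hGT) h6)
    (AdiabatCeiling.partTwo_of_kineticRangeControl hKRC)

/-- **9201-free exact split: given `GaussianTails` (stmt-14415), the crux is EQUIVALENT to (ii) under its prefix ∧ the in-probability
occupation profile under its prefix.**  `⟹`: (ii) is a conjunct, the profile by `occupationInProb_of_aprioriBounds`; `⟸`:
`aprioriBounds_of_partOne_partTwo` with (i) from `partOne_of_farTailAll_occupationInProb`. -/
theorem aprioriBounds_iff_partTwo_and_occupationInProb_of_GT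
    (hGT : Summit.AtomisticToContinuum.HydrodynamicLimit.Theses.UGibbsSRBRigidity.GaussianTails) :
    Summit.AtomisticToContinuum.HydrodynamicLimit.Theses.StiffCollisionalRelaxation.AprioriBounds ↔
    ((∀ (a₀ θ₀ : T3 → ℝ) (u₀ : T3 → V3), Continuous a₀ → Continuous θ₀ → Continuous u₀ →
      (∀ x, 0 < a₀ x) → (∀ x, 0 < θ₀ x) →
      ∃ σ₀ : ℝ, 0 < σ₀ ∧ ∃ η₁ : ℝ, 0 < η₁ ∧ ∀ σ : ℝ, 0 < σ → σ < σ₀ →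
        ∀ (T : ℝ) (ρ θ : ℝ → T3 → ℝ) (u : ℝ → T3 → V3), IsHardSphereEulerSolution σ T ρ u θ →
        ∀ Φ : (N : ℕ) → HardSphereFlow (Torus.geometry (Fin 3)) (hsDiameter σ N) (N + 1),
          TendstoHydroFieldsAt (fun N => localGibbsLaw σ a₀ u₀ θ₀ N (Φ N)) Φ ρ u θ 0 →
          ∀ t : ℝ, 0 < t → t < T → (∀ s ∈ Icc 0 t, ∀ x, 2 * ρ s x * σ ^ 3 < η₁) →
            PartTwoAt σ a₀ θ₀ u₀ Φ t) ∧
    (∀ (a₀ θ₀ : T3 → ℝ) (u₀ : T3 → V3), Continuous a₀ → Continuous θ₀ → Continuous u₀ →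
      (∀ x, 0 < a₀ x) → (∀ x, 0 < θ₀ x) →
      ∃ σ₀ : ℝ, 0 < σ₀ ∧ ∃ η₁ : ℝ, 0 < η₁ ∧ ∀ σ : ℝ, 0 < σ → σ < σ₀ →
        ∀ (T : ℝ) (ρ θ : ℝ → T3 → ℝ) (u : ℝ → T3 → V3), IsHardSphereEulerSolution σ T ρ u θ →
        ∀ Φ : (N : ℕ) → HardSphereFlow (Torus.geometry (Fin 3)) (hsDiameter σ N) (N + 1),
          TendstoHydroFieldsAt (fun N => localGibbsLaw σ a₀ u₀ θ₀ N (Φ N)) Φ ρ u θ 0 →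
          ∀ t : ℝ, 0 < t → t < T → (∀ s ∈ Icc 0 t, ∀ x, 2 * ρ s x * σ ^ 3 < η₁) →
            ∃ Θ A : ℝ, 0 < Θ ∧ ∀ K : ℝ, ∀ η : ℝ, 0 < η →
              Tendsto (fun N : ℕ => localGibbsLaw σ a₀ u₀ θ₀ N (Φ N)
                {z | t * A * Real.exp (-(K / (2 * Θ))) + η <
                  (∫⁻ s in Icc 0 t, ENNReal.ofReal (frac K ((Φ N).flow s z))).toReal}) atTop (𝓝 0))) := by
  refine ⟨fun h => ⟨?_, occupationInProb_of_aprioriBounds h⟩, fun h =>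
    aprioriBounds_of_partOne_partTwo (partOne_of_farTailAll_occupationInProb (farTailAll_of_gaussianTails hGT) h.2) h.1⟩
  intro a₀ θ₀ u₀ ha hθ hu ha0 hθ0
  obtain ⟨σ₀, hσ₀, η₁, hη₁, H⟩ := (AprioriBoundsNegative.aprioriBounds_iff.1 h) a₀ θ₀ u₀ ha hθ hu ha0 hθ0
  exact ⟨σ₀, hσ₀, η₁, hη₁, fun σ hσ hσlt T ρ θ u hsol Φ hLLN t ht htT hdil =>
    (H σ hσ hσlt T ρ θ u hsol Φ hLLN t ht htT hdil).2⟩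

/-- **MODULO THE TWO EXISTING XL ITEMS THE CRUX IS EQUIVALENT TO ITS EXACT THIRD CHILD:
`KineticRangeControl (stmt-9201) → GaussianTails (stmt-14415) → (AprioriBounds ↔ OccupationInProbPrefix)`.** -/
theorem aprioriBounds_iff_occupationInProb_of_KRC_GT
    (hKRC : Summit.AtomisticToContinuum.HydrodynamicLimit.Theses.GermanoSplitLES.KineticRangeControl)
    (hGT : Summit.AtomisticToContinuum.HydrodynamicLimit.Theses.UGibbsSRBRigidity.GaussianTails) :
    Summit.AtomisticToContinuum.HydrodynamicLimit.Theses.StiffCollisionalRelaxation.AprioriBounds ↔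
    (∀ (a₀ θ₀ : T3 → ℝ) (u₀ : T3 → V3), Continuous a₀ → Continuous θ₀ → Continuous u₀ →
      (∀ x, 0 < a₀ x) → (∀ x, 0 < θ₀ x) →
      ∃ σ₀ : ℝ, 0 < σ₀ ∧ ∃ η₁ : ℝ, 0 < η₁ ∧ ∀ σ : ℝ, 0 < σ → σ < σ₀ →
        ∀ (T : ℝ) (ρ θ : ℝ → T3 → ℝ) (u : ℝ → T3 → V3), IsHardSphereEulerSolution σ T ρ u θ →
        ∀ Φ : (N : ℕ) → HardSphereFlow (Torus.geometry (Fin 3)) (hsDiameter σ N) (N + 1),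
          TendstoHydroFieldsAt (fun N => localGibbsLaw σ a₀ u₀ θ₀ N (Φ N)) Φ ρ u θ 0 →
          ∀ t : ℝ, 0 < t → t < T → (∀ s ∈ Icc 0 t, ∀ x, 2 * ρ s x * σ ^ 3 < η₁) →
            ∃ Θ A : ℝ, 0 < Θ ∧ ∀ K : ℝ, ∀ η : ℝ, 0 < η →
              Tendsto (fun N : ℕ => localGibbsLaw σ a₀ u₀ θ₀ N (Φ N)
                {z | t * A * Real.exp (-(K / (2 * Θ))) + η <
                  (∫⁻ s in Icc 0 t, ENNReal.ofReal (frac K ((Φ N).flow s z))).toReal}) atTop (𝓝 0)) :=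
  ⟨occupationInProb_of_aprioriBounds, AprioriBounds_of_KRC_GT_occupationInProb hKRC hGT⟩

/-- The `CollisionIsometryCLT` twin (one `Prop`, `AprioriBoundsNegative.aprioriBoundsPreShock_iff`). -/
theorem aprioriBoundsPreShock_iff_occupationInProb_of_KRC_GT
    (hKRC : Summit.AtomisticToContinuum.HydrodynamicLimit.Theses.GermanoSplitLES.KineticRangeControl)
    (hGT : Summit.AtomisticToContinuum.HydrodynamicLimit.Theses.UGibbsSRBRigidity.GaussianTails) :
    Summit.AtomisticToContinuum.HydrodynamicLimit.Theses.CollisionIsometryCLT.AprioriBoundsPreShock ↔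
    (∀ (a₀ θ₀ : T3 → ℝ) (u₀ : T3 → V3), Continuous a₀ → Continuous θ₀ → Continuous u₀ →
      (∀ x, 0 < a₀ x) → (∀ x, 0 < θ₀ x) →
      ∃ σ₀ : ℝ, 0 < σ₀ ∧ ∃ η₁ : ℝ, 0 < η₁ ∧ ∀ σ : ℝ, 0 < σ → σ < σ₀ →
        ∀ (T : ℝ) (ρ θ : ℝ → T3 → ℝ) (u : ℝ → T3 → V3), IsHardSphereEulerSolution σ T ρ u θ →
        ∀ Φ : (N : ℕ) → HardSphereFlow (Torus.geometry (Fin 3)) (hsDiameter σ N) (N + 1),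
          TendstoHydroFieldsAt (fun N => localGibbsLaw σ a₀ u₀ θ₀ N (Φ N)) Φ ρ u θ 0 →
          ∀ t : ℝ, 0 < t → t < T → (∀ s ∈ Icc 0 t, ∀ x, 2 * ρ s x * σ ^ 3 < η₁) →
            ∃ Θ A : ℝ, 0 < Θ ∧ ∀ K : ℝ, ∀ η : ℝ, 0 < η →
              Tendsto (fun N : ℕ => localGibbsLaw σ a₀ u₀ θ₀ N (Φ N)
                {z | t * A * Real.exp (-(K / (2 * Θ))) + η <
                  (∫⁻ s in Icc 0 t, ENNReal.ofReal (frac K ((Φ N).flow s z))).toReal}) atTop (𝓝 0)) :=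
  aprioriBounds_iff_occupationInProb_of_KRC_GT hKRC hGT

/-! ## The r3 children still dock: sufficient producers of the exact child -/

/-- **`GaussianTails (stmt-14415) → OccupationVariancePrefix → OccupationInProbPrefix`** — the D3 variance child (r2-stub 6,
`Var_{P_N} occ_K → 0` for every `K`) produces the exact child through Chebyshev at each level (`stub_occupationInProb_of_variance`,
p142450) with the far-tail constants of 14415; thresholds `σ₀ := min (min σ₅ σ₆) (1/2)`, `η₁ := min η₅ η₆`. -/
theorem occupationInProb_of_GT_occupationVariance
    (hGT : Summit.AtomisticToContinuum.HydrodynamicLimit.Theses.UGibbsSRBRigidity.GaussianTails)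
    (h6 : ∀ (a₀ θ₀ : T3 → ℝ) (u₀ : T3 → V3), Continuous a₀ → Continuous θ₀ → Continuous u₀ →
      (∀ x, 0 < a₀ x) → (∀ x, 0 < θ₀ x) →
      ∃ σ₀ : ℝ, 0 < σ₀ ∧ ∃ η₁ : ℝ, 0 < η₁ ∧ ∀ σ : ℝ, 0 < σ → σ < σ₀ →
        ∀ (T : ℝ) (ρ θ : ℝ → T3 → ℝ) (u : ℝ → T3 → V3), IsHardSphereEulerSolution σ T ρ u θ →
        ∀ Φ : (N : ℕ) → HardSphereFlow (Torus.geometry (Fin 3)) (hsDiameter σ N) (N + 1),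
          TendstoHydroFieldsAt (fun N => localGibbsLaw σ a₀ u₀ θ₀ N (Φ N)) Φ ρ u θ 0 →
          ∀ t : ℝ, 0 < t → t < T → (∀ s ∈ Icc 0 t, ∀ x, 2 * ρ s x * σ ^ 3 < η₁) →
            ∀ K : ℝ, Tendsto (fun N : ℕ => variance
              (fun z => (∫⁻ s in Icc 0 t, ENNReal.ofReal (frac K ((Φ N).flow s z))).toReal)
              (localGibbsLaw σ a₀ u₀ θ₀ N (Φ N))) atTop (𝓝 0)) :
    ∀ (a₀ θ₀ : T3 → ℝ) (u₀ : T3 → V3), Continuous a₀ → Continuous θ₀ → Continuous u₀ →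
      (∀ x, 0 < a₀ x) → (∀ x, 0 < θ₀ x) →
      ∃ σ₀ : ℝ, 0 < σ₀ ∧ ∃ η₁ : ℝ, 0 < η₁ ∧ ∀ σ : ℝ, 0 < σ → σ < σ₀ →
        ∀ (T : ℝ) (ρ θ : ℝ → T3 → ℝ) (u : ℝ → T3 → V3), IsHardSphereEulerSolution σ T ρ u θ →
        ∀ Φ : (N : ℕ) → HardSphereFlow (Torus.geometry (Fin 3)) (hsDiameter σ N) (N + 1),
          TendstoHydroFieldsAt (fun N => localGibbsLaw σ a₀ u₀ θ₀ N (Φ N)) Φ ρ u θ 0 →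
          ∀ t : ℝ, 0 < t → t < T → (∀ s ∈ Icc 0 t, ∀ x, 2 * ρ s x * σ ^ 3 < η₁) →
            ∃ Θ A : ℝ, 0 < Θ ∧ ∀ K : ℝ, ∀ η : ℝ, 0 < η →
              Tendsto (fun N : ℕ => localGibbsLaw σ a₀ u₀ θ₀ N (Φ N)
                {z | t * A * Real.exp (-(K / (2 * Θ))) + η <
                  (∫⁻ s in Icc 0 t, ENNReal.ofReal (frac K ((Φ N).flow s z))).toReal}) atTop (𝓝 0) := by
  intro a₀ θ₀ u₀ ha hθ hu ha0 hθ0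
  have hP : NiceProfiles a₀ θ₀ u₀ := ⟨ha, hθ, hu, ha0, hθ0⟩
  obtain ⟨σ₅, hσ₅, η₅, hη₅, H5⟩ := farTailAll_of_gaussianTails hGT a₀ θ₀ u₀ ha hθ hu ha0 hθ0
  obtain ⟨σ₆, hσ₆, η₆, hη₆, H6⟩ := h6 a₀ θ₀ u₀ ha hθ hu ha0 hθ0
  refine ⟨min (min σ₅ σ₆) (1 / 2), lt_min (lt_min hσ₅ hσ₆) one_half_pos, min η₅ η₆, lt_min hη₅ hη₆, ?_⟩
  intro σ hσ hσlt T ρ θ u hsol Φ hLLN t ht htT hdil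
  simp only [lt_min_iff] at hσlt hdil
  obtain ⟨⟨hs5, hs6⟩, hshalf⟩ := hσlt
  have hFar : FarTailAllAt σ a₀ θ₀ u₀ Φ t :=
    H5 σ hσ hs5 T ρ θ u hsol Φ hLLN t ht htT (fun s hs x => (hdil s hs x).1)
  have hVar := H6 σ hσ hs6 T ρ θ u hsol Φ hLLN t ht htT (fun s hs x => (hdil s hs x).2)
  exact stub_occupationInProb_of_variance σ a₀ θ₀ u₀ Φ t hσ hshalf.le hP ht hVar hFar

end Summit.AtomisticToContinuum.HydrodynamicLimit.Theorems.MesoChebyshevWindow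

end
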